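import Mathlib
import HarnessLib
import Summits.ValiantsHypothesis.ValiantsHypothesis.Theses.MonotoneRestoration
import Literature.Computability.AlgebraicComplexity.ArithCircuit
import Literature.Computability.AlgebraicComplexity.ArithCircuitProofs
import Literature.Computability.AlgebraicComplexity.MonotoneStructure
import Literature.Computability.AlgebraicComplexity.PermanentIrreducible
import Literature.ModelTheory.FiniteModelTheory.CkEquiv
import Summits.ValiantsHypothesis.ValiantsHypothesis.Theorems.MonotoneRestorationMonotoneRestorationQPCosetCount
import Summits.ValiantsHypothesis.ValiantsHypothesis.Theorems.MonotoneRestorationMonotoneRestorationQPSymmetricLB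
import Summits.ValiantsHypothesis.ValiantsHypothesis.Theorems.MonotoneRestorationMonotoneRestorationQPSupportSymmetrisation
import Summits.ValiantsHypothesis.ValiantsHypothesis.Theorems.MonotoneRestorationMonotoneRestorationQPSparseRegime
import Summits.ValiantsHypothesis.ValiantsHypothesis.Theorems.MonotoneRestorationMonotoneRestorationQPBeta
import Literature.Computability.AlgebraicComplexity.SymmetricArithCircuit
import Literature.Computability.AlgebraicComplexity.DawarWilsenach2025Proofs
import Literature.GroupTheory.PermutationGroups.SmallIndexSubgroups
import Summits.ValiantsHypothesis.ValiantsHypothesis.Theorems.MonotoneRestorationQP.Negative.LoadBearing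
import Summits.ValiantsHypothesis.ValiantsHypothesis.Theorems.MonotoneRestorationMonotoneRestorationQPPermSupportCount

/-! # TTRL-lite variant V20081 of `MonotoneRestorationQP` / `stub_symmetricMonotone_choose_le_card` (stmt-ValiantsHypothesis-15886)

Helper (proved); move `lemma_proposal`, op `llm`: an automorphism fixing a gate permutes its
children (structural half of the orbit-confinement `have`-step). See docs/architecture/ttrl-lite.md. -/

namespace Summit.ValiantsHypothesis.ValiantsHypothesis.Theorems

open Summit.ValiantsHypothesis.ValiantsHypothesis.Theses.MonotoneRestoration
open Literature.Computability.AlgebraicComplexity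

/-- TTRL-lite variant V20081 (lemma_proposal `llm`) of `stub_symmetricMonotone_choose_le_card`
(stmt-ValiantsHypothesis-15886): an automorphism `π` of a labelled arithmetic circuit that fixes a
gate `g` permutes the children of `g` — if `h` is a child of `g` then so is `π h` (immediate from
`children (π g) = π '' children g`, Dawar–Wilsenach Def. 3.6). -/
theorem stub_symmetricMonotone_choose_le_card_var20081 :
    ∀ (n : ℕ) (G : Type) (C : LabelledArithCircuit NNReal (Fin n × Fin n) Unit G)
      (ρ : Equiv.Perm (Fin n)) (π : Equiv.Perm G) (g h : G),
      C.IsAutomorphismExtending ρ π → π g = g → h ∈ C.children g → π h ∈ C.children g := by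
  intro n G C ρ π g h hπ hg hh
  have key : C.children (π g) = (C.children g).map π.toEmbedding := hπ.children_apply g
  rw [hg] at key
  rw [key, Finset.mem_map]
  exact ⟨h, hh, rfl⟩

end Summit.ValiantsHypothesis.ValiantsHypothesis.Theorems
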